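import Summits.BirchSwinnertonDyer.BirchSwinnertonDyer.Theorems.PrintCFramBottomClassIndexLawFiveLeHerbrandKummerGlue
import Literature.NumberTheory.NumberFields.FrobeniusOnRootsOfUnity
import Literature.NumberTheory.GaloisRepresentations.DegreeOnePrimesFixedField
import Literature.NumberTheory.EllipticCurves.KrizLi2019.EisensteinHeegnerLog
import HarnessLib

/-!
# Route `PrintCFram`, crux C2 `BottomClassIndexLawFiveLe` (stmt-BirchSwinnertonDyer-20372), line
# `eisenstein-resource-bdp-line` v10/v11, Stub H — the REFLECTION STEP as theorems, part 9 (avatar toolkit): calculus of the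
# predicate `IsDirichletAvatar` (enlarging the modulus, products, inverses, passage to the primitive character) and the avatar of
# the CYCLOTOMIC character: `teichmullerChar ∘ ā` (with `σζ_p = ζ_p^{ā σ}`) has avatar the Teichmüller Dirichlet character `ω`
# (cell `bsd-print-cfram`, seat `bsd-line-cfram-p1-w8` g0; helper `--supports` 20372; 0 facts, 0 defs)

HONEST FRAMING. Nothing about BSD is proved here. Ninth file of the «reflection as theorems» track; it supplies the bookkeeping a
consumer of part 8's `iInf_eigenspace_classGroup_modP_eq_bot_of_even_of_mazurWiles` needs to manufacture the hypothesis
`IsDirichletAvatar K (teichmullerChar p ∘ ψ̄) ψ m` for `ψ̄ = ā · χ̄⁻¹` from (i) the avatar of `teichmullerChar ∘ ā` — the Teichmüller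
character `ω` (this file, from Frobenius acting on `ζ_p` as `ζ ↦ ζ^ℓ`, tree `FrobeniusOnRootsOfUnity`) — and (ii) an avatar of
`teichmullerChar ∘ χ̄` (the line character's Dirichlet datum, LEAD g8's T1 files / w6's `isDirichletAvatar_of_forall_absGaloisQuot`),
via `mul`, `inv` and `primitiveCharacter`.

* `IsDirichletAvatar.of_dvd` — enlarge the excluded modulus;
* `IsDirichletAvatar.mul`, `IsDirichletAvatar.inv` — products and inverses (levels multiply / excluded modulus absorbs the levels);
* `IsDirichletAvatar.primitiveCharacter` — pass to the primitive character;
* **`isDirichletAvatar_teichmullerChar_comp`** — `σζ = ζ^{(ā σ).val}` for all `σ` and `ω` Teichmüller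
  (`KrizLi2019.IsTeichmullerCharacter ω`) ⟹ `IsDirichletAvatar K ((teichmullerChar p).comp ā) ω p`.

THEOREMS ONLY; no definition, no named fact, no `sorry`; imports no `Theses` module. BSD is not proved by any of this; no summit
statement is proved by this seat.
References: [Washington1997] §5.1 (Teichmüller character), Thm. 2.5-type Frobenius action on roots of unity; [Lang1990] Ch. 1 §2;
[NeukirchANT1999] Ch. I §9 (Frobenius).
-/

set_option autoImplicit false
-- `…BirchSwinnertonDyer.BirchSwinnertonDyer.Theorems…` is the problem's mandated namespace (D-0017).
set_option linter.dupNamespace false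

noncomputable section

namespace Summit.BirchSwinnertonDyer.BirchSwinnertonDyer.Theorems.PrintCFram.HerbrandKummer

open Literature.NumberTheory.NumberFields Literature.NumberTheory.EllipticCurves.Kato2004
open Literature.NumberTheory.EllipticCurves.KrizLi2019 Literature.NumberTheory.GaloisRepresentations
open NumberField IsDedekindDomain
open scoped nonZeroDivisors

section Avatar

variable {K : Type} [Field K] [NumberField K] {p : ℕ} [Fact p.Prime]

/-- A prime `ℓ` not dividing `m·n` divides neither factor. [folklore] -/
private theorem not_dvd_of_not_dvd_mul_left {ℓ m n : ℕ} (h : ¬ ℓ ∣ m * n) : ¬ ℓ ∣ m := fun h' => h (h'.mul_right n)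

/-- A prime `ℓ` not dividing `m·n` does not divide `n`. [folklore] -/
private theorem not_dvd_of_not_dvd_mul_right {ℓ m n : ℕ} (h : ¬ ℓ ∣ m * n) : ¬ ℓ ∣ n := fun h' => h (h'.mul_left m)

/-- `ℓ ∤ f` for a prime `ℓ` gives `IsCoprime (ℓ : ℤ) f`. [folklore] -/
private theorem isCoprime_natCast_of_prime_not_dvd {ℓ f : ℕ} (hℓ : ℓ.Prime) (h : ¬ ℓ ∣ f) : IsCoprime (ℓ : ℤ) (f : ℤ) := by
  rw [Int.isCoprime_iff_gcd_eq_one, Int.gcd_natCast_natCast]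
  exact (Nat.Prime.coprime_iff_not_dvd hℓ).2 h

/-- **Enlarging the excluded modulus.** [cite: Solomon1990, §II.2 p. 471 (χ(n) for (n,f) = 1)] -/
theorem IsDirichletAvatar.of_dvd {θ : (K ≃ₐ[ℚ] K) →* ℤ_[p]ˣ} {f : ℕ} {χ : DirichletCharacter ℚ_[p] f} {m m' : ℕ}
    (h : IsDirichletAvatar K θ χ m) (hmm' : m ∣ m') (hm' : 0 < m') : IsDirichletAvatar K θ χ m' :=
  ⟨hm', fun ℓ hℓ hℓm' v hv σ hσ => h.2 ℓ hℓ (fun hd => hℓm' (hd.trans hmm')) v hv σ hσ⟩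

/-- **Products of avatars**: if `χ₁` (level `f₁`) is the avatar of `θ₁` away from `m₁` and `χ₂` (level `f₂`) that of `θ₂` away from
`m₂`, then `changeLevel χ₁ · changeLevel χ₂` (level `f₁ f₂`) is the avatar of `θ₁ θ₂` away from `m₁ m₂ f₁ f₂`.
[cite: Solomon1990, §II.2 p. 471] -/
theorem IsDirichletAvatar.mul {θ₁ θ₂ : (K ≃ₐ[ℚ] K) →* ℤ_[p]ˣ} {f₁ f₂ : ℕ} [NeZero f₁] [NeZero f₂]
    {χ₁ : DirichletCharacter ℚ_[p] f₁} {χ₂ : DirichletCharacter ℚ_[p] f₂} {m₁ m₂ : ℕ}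
    (h₁ : IsDirichletAvatar K θ₁ χ₁ m₁) (h₂ : IsDirichletAvatar K θ₂ χ₂ m₂) :
    IsDirichletAvatar K (θ₁ * θ₂)
      (DirichletCharacter.changeLevel (dvd_mul_right f₁ f₂) χ₁ * DirichletCharacter.changeLevel (dvd_mul_left f₂ f₁) χ₂)
      (m₁ * m₂ * (f₁ * f₂)) := by
  refine ⟨Nat.mul_pos (Nat.mul_pos h₁.1 h₂.1) (Nat.mul_pos (Nat.pos_of_ne_zero (NeZero.ne f₁))
    (Nat.pos_of_ne_zero (NeZero.ne f₂))), fun ℓ hℓ hℓm v hv σ hσ => ?_⟩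
  have hℓm₁ : ¬ ℓ ∣ m₁ := not_dvd_of_not_dvd_mul_left (not_dvd_of_not_dvd_mul_left hℓm)
  have hℓm₂ : ¬ ℓ ∣ m₂ := not_dvd_of_not_dvd_mul_right (not_dvd_of_not_dvd_mul_left hℓm)
  have hℓf : ¬ ℓ ∣ f₁ * f₂ := not_dvd_of_not_dvd_mul_right hℓm
  have hcop : IsCoprime (ℓ : ℤ) ((f₁ * f₂ : ℕ) : ℤ) := isCoprime_natCast_of_prime_not_dvd hℓ hℓf
  have e₁ := h₁.2 ℓ hℓ hℓm₁ v hv σ hσ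
  have e₂ := h₂.2 ℓ hℓ hℓm₂ v hv σ hσ
  rw [MonoidHom.mul_apply, Units.val_mul, PadicInt.coe_mul, e₁, e₂, MulChar.mul_apply]
  have c₁ := DirichletCharacter.changeLevel_eq_cast_of_dvd' χ₁ (dvd_mul_right f₁ f₂) (a := (ℓ : ℤ)) hcop
  have c₂ := DirichletCharacter.changeLevel_eq_cast_of_dvd' χ₂ (dvd_mul_left f₂ f₁) (a := (ℓ : ℤ)) hcop
  simp only [Int.cast_natCast] at c₁ c₂
  rw [c₁, c₂]

/-- **Inverses of avatars**: `χ⁻¹` is the avatar of `θ⁻¹` (away from `m·f`). [cite: Solomon1990, §II.2 p. 471] -/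
theorem IsDirichletAvatar.inv {θ : (K ≃ₐ[ℚ] K) →* ℤ_[p]ˣ} {f : ℕ} [NeZero f] {χ : DirichletCharacter ℚ_[p] f} {m : ℕ}
    (h : IsDirichletAvatar K θ χ m) : IsDirichletAvatar K θ⁻¹ χ⁻¹ (m * f) := by
  refine ⟨Nat.mul_pos h.1 (Nat.pos_of_ne_zero (NeZero.ne f)), fun ℓ hℓ hℓm v hv σ hσ => ?_⟩
  have e := h.2 ℓ hℓ (not_dvd_of_not_dvd_mul_left hℓm) v hv σ hσ
  rw [MonoidHom.inv_apply, MulChar.inv_apply_eq_inv', ← e]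
  exact eq_inv_of_mul_eq_one_left (by rw [← PadicInt.coe_mul, ← Units.val_mul, inv_mul_cancel, Units.val_one, PadicInt.coe_one])

/-- **Passage to the primitive character**: the avatar relation survives for `χ.primitiveCharacter` (away from `m·f`).
[cite: Solomon1990, §II.2 p. 471 ("The conductor of χ will be denoted f")] -/
theorem IsDirichletAvatar.primitiveCharacter {θ : (K ≃ₐ[ℚ] K) →* ℤ_[p]ˣ} {f : ℕ} [NeZero f] {χ : DirichletCharacter ℚ_[p] f}
    {m : ℕ} (h : IsDirichletAvatar K θ χ m) : IsDirichletAvatar K θ χ.primitiveCharacter (m * f) := by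
  refine ⟨Nat.mul_pos h.1 (Nat.pos_of_ne_zero (NeZero.ne f)), fun ℓ hℓ hℓm v hv σ hσ => ?_⟩
  have e := h.2 ℓ hℓ (not_dvd_of_not_dvd_mul_left hℓm) v hv σ hσ
  have hcop : IsCoprime (ℓ : ℤ) (f : ℤ) := isCoprime_natCast_of_prime_not_dvd hℓ (not_dvd_of_not_dvd_mul_right hℓm)
  have c := DirichletCharacter.primitiveCharacter_apply_of_isCoprime χ hcop
  simp only [Int.cast_natCast] at c
  rw [c, e]

omit [NumberField K] in
/-- The prime of `ℤ` under a prime `v ∋ ℓ` of `𝓞 K` is `(ℓ)`. [folklore] -/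
private theorem liesOver_span_of_mem (v : HeightOneSpectrum (𝓞 K)) {ℓ : ℕ} (hℓ : ℓ.Prime) (hv : ((ℓ : ℕ) : 𝓞 K) ∈ v.asIdeal) :
    v.asIdeal.LiesOver (Ideal.span {(ℓ : ℤ)}) := by
  haveI := v.isPrime
  refine ⟨?_⟩
  have hmax : (Ideal.span {(ℓ : ℤ)}).IsMaximal :=
    PrincipalIdealRing.isMaximal_of_irreducible (Nat.prime_iff_prime_int.mp hℓ).irreducible
  refine (hmax.eq_of_le (Ideal.comap_ne_top _ v.isPrime.ne_top) ?_)
  rw [Ideal.span_le, Set.singleton_subset_iff]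
  change algebraMap ℤ (𝓞 K) (ℓ : ℤ) ∈ v.asIdeal
  rw [map_natCast]
  exact hv

/-- Ultrametric step in `ℚ_p`: `‖x − y‖ < 1` and `‖y‖ = 1` force `‖x‖ = 1`. [folklore] -/
theorem padic_norm_eq_one_of_norm_sub_lt_one {x y : ℚ_[p]} (h : ‖x - y‖ < 1) (hy : ‖y‖ = 1) : ‖x‖ = 1 := by
  have h1 : ‖x - y‖ < ‖y‖ := by rw [hy]; exact h
  have h2 := Padic.add_eq_max_of_ne (p := p) h1.ne
  rw [sub_add_cancel, max_eq_right h1.le] at h2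
  rw [h2, hy]

/-- **The avatar of the cyclotomic character is the Teichmüller character.** Let `ζ ∈ K` be a primitive `p`-th root of unity and
`ā : Gal(K/ℚ) →* (ℤ/p)ˣ` the character with `σζ = ζ^{(ā σ).val}`; let `ω` be the Teichmüller Dirichlet character mod `p` with
values in `ℚ_p` (`ω(a) ≡ a`). Then `ω` is the Dirichlet avatar of `teichmullerChar p ∘ ā` away from `p`: at an arithmetic Frobenius
`σ` at `v ∣ ℓ ≠ p`, `σζ ≡ ζ^ℓ (mod v)` forces `ζ^{ā σ} = ζ^ℓ` (roots of unity of order `p` are distinct mod `v`), so `ā σ = ℓ` in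
`ℤ/p`, and `ω(ℓ)`, `teichmullerChar (ā σ)` are the same `(p−1)`-th root of unity (both `≡ ℓ`).
[cite: Washington1997, §5.1 (ω(a) ≡ a mod p); Thm. 2.5-type Frobenius action σ_ℓ ζ = ζ^ℓ] [cite: Lang1990, Ch. 1 §2] -/
theorem isDirichletAvatar_teichmullerChar_comp {ζ : K} (hζ : IsPrimitiveRoot ζ p) (ā : (K ≃ₐ[ℚ] K) →* (ZMod p)ˣ)
    (hā : ∀ σ : K ≃ₐ[ℚ] K, σ ζ = ζ ^ ((ā σ : (ZMod p)ˣ) : ZMod p).val)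
    (ω : DirichletCharacter ℚ_[p] p) (hω : IsTeichmullerCharacter ω) :
    IsDirichletAvatar K ((teichmullerChar p).comp ā) ω p := by
  have hp : p.Prime := Fact.out
  refine ⟨hp.pos, fun ℓ hℓ hℓp v hv σ hσ => ?_⟩
  haveI := v.isPrime
  haveI : v.asIdeal.LiesOver (Ideal.span {(ℓ : ℤ)}) := liesOver_span_of_mem v hℓ hv
  haveI : Fact ℓ.Prime := ⟨hℓ⟩
  -- `σ ζ' ≡ ζ'^ℓ (mod v)` for `ζ' = ζ ∈ 𝓞 K`
  have hint : IsIntegral ℤ ζ := IsIntegral.of_pow hp.pos (by rw [hζ.pow_eq_one]; exact isIntegral_one)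
  set ζ' : 𝓞 K := ⟨ζ, hint⟩ with hζ'
  have hζ'p : ζ' ^ p = 1 := Subtype.ext (by
    change ((ζ' ^ p : 𝓞 K) : K) = 1
    rw [RingOfIntegers.coe_eq_algebraMap, map_pow]; exact hζ.pow_eq_one)
  have hfrob := (DegreeOnePrimes.isArithFrobAt_int_iff ℓ σ v.asIdeal).mp hσ ζ'
  -- `σ • ζ' = ζ'^{ā σ}`
  have hσζ' : σ • ζ' = ζ' ^ ((ā σ : (ZMod p)ˣ) : ZMod p).val := Subtype.ext (by
    change σ ζ = (((ζ' ^ ((ā σ : (ZMod p)ˣ) : ZMod p).val : 𝓞 K)) : K)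
    rw [hā σ, RingOfIntegers.coe_eq_algebraMap, map_pow]; rfl)
  rw [hσζ'] at hfrob
  -- `p ∉ v` since `ℓ ≠ p`
  have hpv : ((p : ℕ) : 𝓞 K) ∉ v.asIdeal := by
    intro hpv
    have h1 : ((p : ℤ) : 𝓞 K) ∈ v.asIdeal := by exact_mod_cast hpv
    have h2 : (p : ℤ) ∈ v.asIdeal.under ℤ := h1
    rw [← Ideal.LiesOver.over (p := Ideal.span {(ℓ : ℤ)}) (P := v.asIdeal), Ideal.mem_span_singleton] at h2
    have h3 := (Nat.prime_dvd_prime_iff_eq hℓ hp).mp (by exact_mod_cast h2)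
    exact hℓp (h3 ▸ dvd_refl _)
  -- roots of unity of order `p` are distinct mod `v`
  have heq : ζ' ^ ((ā σ : (ZMod p)ˣ) : ZMod p).val = ζ' ^ ℓ :=
    eq_of_pow_eq_one_of_sub_mem hpv (by rw [← pow_mul, mul_comm, pow_mul, hζ'p, one_pow])
      (by rw [← pow_mul, mul_comm, pow_mul, hζ'p, one_pow]) hfrob
  have heqK : ζ ^ ((ā σ : (ZMod p)ˣ) : ZMod p).val = ζ ^ ℓ := by
    have hζ'K : algebraMap (𝓞 K) K ζ' = ζ := rfl
    have := congrArg (fun z : 𝓞 K => (z : K)) heq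
    simpa only [RingOfIntegers.coe_eq_algebraMap, map_pow, hζ'K] using this
  -- hence `ā σ = ℓ` in `ℤ/p`
  have hval : ((ā σ : (ZMod p)ˣ) : ZMod p) = (ℓ : ZMod p) := by
    have hord : orderOf ζ = p := hζ.eq_orderOf.symm
    have h1 : ζ ^ (((ā σ : (ZMod p)ˣ) : ZMod p).val % orderOf ζ) = ζ ^ (ℓ % orderOf ζ) := by
      rw [pow_mod_orderOf, pow_mod_orderOf, heqK]
    rw [hord] at h1
    have h2 := hζ.pow_inj (Nat.mod_lt _ hp.pos) (Nat.mod_lt _ hp.pos) h1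
    rw [← ZMod.natCast_zmod_val ((ā σ : (ZMod p)ˣ) : ZMod p), ZMod.natCast_eq_natCast_iff']
    exact h2
  -- `ω ℓ ≡ ℓ (mod p)` and `‖ℓ‖_p = 1`, so `ω ℓ ∈ ℤ_pˣ`
  have hpℓ : ¬ p ∣ ℓ := fun h => hℓp (by rw [(Nat.prime_dvd_prime_iff_eq hp hℓ).mp h])
  have hωnorm : ‖ω (ℓ : ZMod p) - (ℓ : ℚ_[p])‖ < 1 := by
    have := hω (ℓ : ℤ) (fun h => hpℓ (Int.natCast_dvd_natCast.mp h))
    simpa only [Int.cast_natCast] using this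
  have hℓnorm : ‖(ℓ : ℚ_[p])‖ = 1 := by
    rw [← PadicInt.coe_natCast, ← PadicInt.norm_def, PadicInt.norm_natCast_eq_one_iff]
    exact (Nat.coprime_primes hp hℓ).2 (fun h => hpℓ (h ▸ dvd_refl p))
  have hω1 : ‖ω (ℓ : ZMod p)‖ = 1 := padic_norm_eq_one_of_norm_sub_lt_one hωnorm hℓnorm
  set u0 : ℤ_[p] := ⟨ω (ℓ : ZMod p), hω1.le⟩ with hu0def
  have hu0 : IsUnit u0 := PadicInt.isUnit_iff.mpr hω1
  have huval : ((hu0.unit : ℤ_[p]) : ℚ_[p]) = ω (ℓ : ZMod p) := by rw [IsUnit.unit_spec]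
  -- `(ω ℓ)^{p-1} = ω(ℓ^{p-1}) = 1`
  have hℓ0 : (ℓ : ZMod p) ≠ 0 := fun h => hpℓ ((ZMod.natCast_eq_zero_iff ℓ p).mp h)
  have hup : hu0.unit ^ (p - 1) = 1 := by
    refine Units.ext (Subtype.ext ?_)
    change (((hu0.unit ^ (p - 1) : ℤ_[p]ˣ) : ℤ_[p]) : ℚ_[p]) = ((1 : ℤ_[p]) : ℚ_[p])
    rw [Units.val_pow_eq_pow_val, PadicInt.coe_pow, PadicInt.coe_one, huval, ← map_pow,
      ZMod.pow_card_sub_one_eq_one hℓ0, map_one]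
  -- `ω ℓ ≡ ℓ = ā σ (mod p)`, so `ω ℓ = teichmullerChar (ā σ)` by uniqueness of the Teichmüller representative
  have hua : PadicInt.toZMod (hu0.unit : ℤ_[p]) = ((ā σ : (ZMod p)ˣ) : ZMod p) := by
    rw [IsUnit.unit_spec, hval, ← norm_sub_natCast_lt_one_iff_toZMod_eq, PadicInt.norm_def, PadicInt.coe_sub,
      PadicInt.coe_natCast]
    exact hωnorm
  have hu : hu0.unit = teichmullerChar p (ā σ) := eq_teichmullerChar p hup hua
  rw [MonoidHom.comp_apply, ← hu, huval]

end Avatar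

end Summit.BirchSwinnertonDyer.BirchSwinnertonDyer.Theorems.PrintCFram.HerbrandKummer

end
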